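import Summits.Schanuel.Schanuel.Theorems.RootDecomp1AtomRigidity
import Literature.NumberTheory.Transcendental.PeriodsWave0
import Literature.NumberTheory.Transcendental.LindemannWeierstrassProofs

/-!
# RootDecomp1 — SHARED DEGREE: transcendentals common to `ℚ(z)` and `ℚ(e^z)` force entanglement

Summits-side kernel lemmas for the round-6 entanglement split of `route-Schanuel-RootDecomp1`
(`NonrationalSaturatedEssentialSchanuel` 29645 ⟸ `EntangledSaturatedEssentialSchanuel` 30352 ∧
`DisjointSaturatedEssentialSchanuel` 30353, glue landed in `Theorems/RootDecomp1EntanglementSplit.lean`).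
Source: lens-1 gen-10 node `run/shared/lean/pub/decomp-schanuel/decomp-schanuel-lens-1/g10/FaceLayer.lean` §2
(ported verbatim; `--supports stmt-Schanuel-30352`).

With `t = trdeg ℚ(z, e^z)`, `t₁ = trdeg ℚ(z)`, `t₂ = trdeg ℚ(e^z)` and the SHARED DEGREE `σ = trdeg (ℚ(z) ∩ ℚ(e^z))`:

* `trdeg_union_add_trdeg_inf_le` — rank submodularity `t + σ ≤ t₁ + t₂` for arbitrary generating sets `S, T ⊆ ℂ`
  (algebraic matroid `AlgebraicIndependent.matroid ℚ ℂ`: a transcendence basis of the intersection extends to a basis of `T`);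
* `trdeg_union_add_one_le_of_shared` / `entangled_of_shared_transcendental` — ONE transcendental `s ∈ ℚ(z) ∩ ℚ(e^z)` already gives
  `t < t₁ + t₂`, i.e. the ENTANGLED hypothesis of item 30352 and the negation of the DISJOINT hypothesis of item 30353;
* `isAlgebraic_of_mem_inf_of_disjoint` — conversely on the DISJOINT class (`t₁ + t₂ ≤ t`) the two fields share only algebraic numbers;
* placements (every hypothesis discharged in the kernel, Hermite–Lindemann = tree theorem `transcendental_exp_holds`):
  fixed points `e^ζ = ζ` in the ℚ-span (`entangled_of_fixedPoint_mem_span`, `_coord`, `not_disjoint_of_fixedPoint_mem_span`),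
  Lambert points `Ω e^Ω = 1` (`entangled_of_lambert_mem_span`), exponential chains `e^{z_i} = z_j` with `z_j` transcendental
  (`entangled_of_chain`), hence the e-tower `(1, e, e²)` (`eTower_entangled`) and the deep tower `(1, e, e^e)` (`deepTower_entangled`)
  all lie on the `Cᵉ` = 30352 side of the split, never in `D` = 30353.

No `sorry`, no new axioms, no instances, no notation.
-/

set_option linter.dupNamespace false

noncomputable section

namespace Summit.Schanuel.Schanuel.Theorems.RootDecomp1SharedDegree

open Complex IntermediateField
open scoped BigOperators Cardinal
open Summit.Schanuel.Schanuel.Theorems.RootDecomp1EAnchor (trdeg_adjoin_le_of_isAlgebraic trdeg_adjoin_union_le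
  exists_nat_eq_of_le_natCast isAlgebraic_of_mem_adjoin)
open Summit.Schanuel.Schanuel.Theorems.RootDecomp1AtomRigidity (exp_mem_adjoin_exp_of_mem_span_int)
open Literature.NumberTheory.Transcendental (transcendental_exp_holds exists_nsmul_mem_span_int
  isAlgebraic_adjoin_over_algebraAdjoin)

/-! ## §1  Rank submodularity and the shared transcendental -/

/-- `trdeg_ℚ ℚ(S) ≤ #S`. [folklore] -/
private theorem trdeg_adjoin_le_mk {F E : Type*} [Field F] [Field E] [Algebra F E] (S : Set E) :
    Algebra.trdeg F ↥(adjoin F S) ≤ #S := by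
  haveI := isAlgebraic_adjoin_over_algebraAdjoin (F := F) S
  exact (Algebra.IsAlgebraic.trdeg_le_cardinalMk F (((↑) : adjoin F S → E) ⁻¹' S)).trans
    (Cardinal.mk_preimage_of_injective _ _ Subtype.val_injective)

/-- A finite cardinal `c ≤ n` with `c + 1 ≤ d` is `< d`. -/
theorem lt_of_add_one_le_of_le_nat {c d : Cardinal} {n : ℕ} (hc : c ≤ (n : Cardinal)) (h : c + 1 ≤ d) : c < d := by
  obtain ⟨a, rfl, -⟩ := exists_nat_eq_of_le_natCast hc
  have : (a : Cardinal) < (a : Cardinal) + 1 := by exact_mod_cast Nat.lt_succ_self a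
  exact this.trans_le h

/-- **STRICT SUBADDITIVITY FROM A SHARED TRANSCENDENTAL.**  If `s ∈ ℚ(S) ∩ ℚ(T)` is transcendental (`S, T ⊆ ℂ` arbitrary) then
`trdeg ℚ(S ∪ T) + 1 ≤ trdeg ℚ(S) + trdeg ℚ(T)`.  Proof: in the algebraic matroid of `ℂ/ℚ` extend the independent set `{s}`
to a basis `B ⊆ {s} ∪ T` of `{s} ∪ T`; then `#B ≤ trdeg ℚ(T)` (all of `B` lies in `ℚ(T)`), every generator of `ℚ(S ∪ T)` is
algebraic over `ℚ(S ∪ (B ∖ {s}))` (because `s ∈ ℚ(S)`), and `#(B ∖ {s}) + 1 = #B`. [folklore; this node] -/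
theorem trdeg_union_add_one_le_of_shared {S T : Set ℂ} {s : ℂ}
    (hsS : s ∈ adjoin ℚ S) (hsT : s ∈ adjoin ℚ T) (hs : Transcendental ℚ s) :
    Algebra.trdeg ℚ ↥(adjoin ℚ (S ∪ T)) + 1 ≤
      Algebra.trdeg ℚ ↥(adjoin ℚ S) + Algebra.trdeg ℚ ↥(adjoin ℚ T) := by
  classical
  -- the algebraic matroid of ℂ over ℚ
  have hI : (AlgebraicIndependent.matroid ℚ ℂ).Indep ({s} : Set ℂ) := by
    rw [AlgebraicIndependent.matroid_indep_iff]
    exact (algebraicIndependent_singleton_iff (R := ℚ) (x := fun i : ({s} : Set ℂ) => id (i : ℂ))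
      ⟨s, Set.mem_singleton s⟩).mpr hs
  obtain ⟨B, hB, hsB⟩ := hI.subset_isBasis_of_subset (Set.singleton_subset_iff.mpr (Set.mem_insert s T))
    (by simp)
  rw [AlgebraicIndependent.matroid_isBasis_iff] at hB
  obtain ⟨hBind, hBX, hBalg⟩ := hB
  have hsB' : s ∈ B := hsB (Set.mem_singleton s)
  -- (1) #B ≤ trdeg ℚ(T)
  have hmemT : ∀ b ∈ B, b ∈ adjoin ℚ T := by
    intro b hb
    rcases hBX hb with rfl | hbT
    · exact hsT
    · exact subset_adjoin ℚ T hbT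
  have hBle : #B ≤ Algebra.trdeg ℚ ↥(adjoin ℚ T) := by
    let y : B → ↥(adjoin ℚ T) := fun b => ⟨b, hmemT b b.2⟩
    have hy : AlgebraicIndependent ℚ y := AlgebraicIndependent.of_comp (adjoin ℚ T).val hBind
    exact hy.cardinalMk_le_trdeg
  -- (2) generators of ℚ(S ∪ T) are algebraic over ℚ(S ∪ B') with B' = B \ {s}
  set B' : Set ℂ := B \ {s} with hB'def
  have hle : Algebra.adjoin ℚ B ≤ (adjoin ℚ (S ∪ B')).toSubalgebra := by
    refine Algebra.adjoin_le ?_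
    intro b hb
    by_cases hbs : b = s
    · subst hbs
      exact adjoin.mono ℚ _ _ Set.subset_union_left hsS
    · exact subset_adjoin ℚ _ (Or.inr ⟨hb, hbs⟩)
  have hgen : ∀ x ∈ S ∪ T, IsAlgebraic ↥(adjoin ℚ (S ∪ B')) x := by
    rintro x (hxS | hxT)
    · exact isAlgebraic_of_mem_adjoin (adjoin.mono ℚ _ _ Set.subset_union_left (subset_adjoin ℚ S hxS))
    · exact (hBalg x (Set.mem_insert_of_mem s hxT)).tower_top_of_subalgebra_le hle
  have h1 : Algebra.trdeg ℚ ↥(adjoin ℚ (S ∪ T)) ≤ Algebra.trdeg ℚ ↥(adjoin ℚ (S ∪ B')) :=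
    trdeg_adjoin_le_of_isAlgebraic hgen
  have h2 : Algebra.trdeg ℚ ↥(adjoin ℚ (S ∪ B')) ≤
      Algebra.trdeg ℚ ↥(adjoin ℚ B') + Algebra.trdeg ℚ ↥(adjoin ℚ S) := trdeg_adjoin_union_le S B'
  have h3 : Algebra.trdeg ℚ ↥(adjoin ℚ B') ≤ #B' := trdeg_adjoin_le_mk B'
  -- (3) #B' + 1 = #B
  have h4 : #B' + 1 = #B := by
    have hns : s ∉ B' := fun h => h.2 (Set.mem_singleton s)
    rw [← Cardinal.mk_insert hns, hB'def, Set.insert_sdiff_singleton, Set.insert_eq_of_mem hsB']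
  calc Algebra.trdeg ℚ ↥(adjoin ℚ (S ∪ T)) + 1
      ≤ (Algebra.trdeg ℚ ↥(adjoin ℚ B') + Algebra.trdeg ℚ ↥(adjoin ℚ S)) + 1 :=
        add_le_add (h1.trans h2) le_rfl
    _ = Algebra.trdeg ℚ ↥(adjoin ℚ S) + (Algebra.trdeg ℚ ↥(adjoin ℚ B') + 1) := by
        rw [add_comm (Algebra.trdeg ℚ ↥(adjoin ℚ B')), add_assoc]
    _ ≤ Algebra.trdeg ℚ ↥(adjoin ℚ S) + (#B' + 1) :=
        add_le_add le_rfl (add_le_add h3 le_rfl)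
    _ = Algebra.trdeg ℚ ↥(adjoin ℚ S) + #B := by rw [h4]
    _ ≤ Algebra.trdeg ℚ ↥(adjoin ℚ S) + Algebra.trdeg ℚ ↥(adjoin ℚ T) := add_le_add le_rfl hBle

/-- **SUBMODULARITY OF `trdeg` ACROSS TWO GENERATED FIELDS (the graded form).**  For any `S, T ⊆ ℂ`,
`trdeg ℚ(S ∪ T) + trdeg (ℚ(S) ⊓ ℚ(T)) ≤ trdeg ℚ(S) + trdeg ℚ(T)`: the SHARED DEGREE `σ = trdeg(ℚ(S) ∩ ℚ(T))` is a lower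
bound for the entanglement grade `ε = trdeg ℚ(S) + trdeg ℚ(T) − trdeg ℚ(S ∪ T)`.  Proof: a transcendence basis `B₀` of the
intersection field extends to a basis `B ⊆ B₀ ∪ T` of `B₀ ∪ T` in the algebraic matroid; `#B ≤ trdeg ℚ(T)`, the generators
of `ℚ(S ∪ T)` are algebraic over `ℚ(S ∪ (B ∖ B₀))`, and `#(B ∖ B₀) + #B₀ = #B`. [folklore (rank submodularity of the
algebraic matroid); this node] -/
theorem trdeg_union_add_trdeg_inf_le (S T : Set ℂ) :
    Algebra.trdeg ℚ ↥(adjoin ℚ (S ∪ T)) + Algebra.trdeg ℚ ↥(adjoin ℚ S ⊓ adjoin ℚ T) ≤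
      Algebra.trdeg ℚ ↥(adjoin ℚ S) + Algebra.trdeg ℚ ↥(adjoin ℚ T) := by
  classical
  set M : IntermediateField ℚ ℂ := adjoin ℚ S ⊓ adjoin ℚ T with hMdef
  -- a transcendence basis of the intersection field, pushed into ℂ
  haveI : FaithfulSMul ℚ ↥M := (faithfulSMul_iff_algebraMap_injective ℚ ↥M).2 (algebraMap ℚ ↥M).injective
  obtain ⟨B₀', hB₀'⟩ := exists_isTranscendenceBasis ℚ ↥M
  set v : ↥B₀' → ℂ := fun b => ((b : ↥M) : ℂ) with hvdef
  have hv : AlgebraicIndependent ℚ v := hB₀'.1.map' (f := M.val) Subtype.val_injective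
  set B₀ : Set ℂ := Set.range v with hB₀def
  have hB₀M : B₀ ⊆ (M : Set ℂ) := by rintro _ ⟨b, rfl⟩; exact (b : ↥M).2
  have hB₀card : #B₀ = Algebra.trdeg ℚ ↥M := by
    rw [hB₀def, Cardinal.mk_range_eq v hv.injective]; exact hB₀'.cardinalMk_eq_trdeg
  have hI : (AlgebraicIndependent.matroid ℚ ℂ).Indep B₀ := by
    rw [AlgebraicIndependent.matroid_indep_iff]; exact hv.to_subtype_range
  obtain ⟨B, hB, hB₀B⟩ := hI.subset_isBasis_of_subset (Set.subset_union_left (t := T)) (by simp)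
  rw [AlgebraicIndependent.matroid_isBasis_iff] at hB
  obtain ⟨hBind, hBX, hBalg⟩ := hB
  -- (1) #B ≤ trdeg ℚ(T)
  have hmemT : ∀ b ∈ B, b ∈ adjoin ℚ T := by
    intro b hb
    rcases hBX hb with hb₀ | hbT
    · exact (inf_le_right : M ≤ adjoin ℚ T) (hB₀M hb₀)
    · exact subset_adjoin ℚ T hbT
  have hBle : #B ≤ Algebra.trdeg ℚ ↥(adjoin ℚ T) := by
    let y : B → ↥(adjoin ℚ T) := fun b => ⟨b, hmemT b b.2⟩
    have hy : AlgebraicIndependent ℚ y := AlgebraicIndependent.of_comp (adjoin ℚ T).val hBind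
    exact hy.cardinalMk_le_trdeg
  -- (2) generators of ℚ(S ∪ T) are algebraic over ℚ(S ∪ B') with B' = B \ B₀
  set B' : Set ℂ := B \ B₀ with hB'def
  have hle : Algebra.adjoin ℚ B ≤ (adjoin ℚ (S ∪ B')).toSubalgebra := by
    refine Algebra.adjoin_le ?_
    intro b hb
    by_cases hb₀ : b ∈ B₀
    · exact adjoin.mono ℚ _ _ Set.subset_union_left ((inf_le_left : M ≤ adjoin ℚ S) (hB₀M hb₀))
    · exact subset_adjoin ℚ _ (Or.inr ⟨hb, hb₀⟩)
  have hgen : ∀ x ∈ S ∪ T, IsAlgebraic ↥(adjoin ℚ (S ∪ B')) x := by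
    rintro x (hxS | hxT)
    · exact isAlgebraic_of_mem_adjoin (adjoin.mono ℚ _ _ Set.subset_union_left (subset_adjoin ℚ S hxS))
    · exact (hBalg x (Set.mem_union_right _ hxT)).tower_top_of_subalgebra_le hle
  have h1 : Algebra.trdeg ℚ ↥(adjoin ℚ (S ∪ T)) ≤ Algebra.trdeg ℚ ↥(adjoin ℚ (S ∪ B')) :=
    trdeg_adjoin_le_of_isAlgebraic hgen
  have h2 : Algebra.trdeg ℚ ↥(adjoin ℚ (S ∪ B')) ≤
      Algebra.trdeg ℚ ↥(adjoin ℚ B') + Algebra.trdeg ℚ ↥(adjoin ℚ S) := trdeg_adjoin_union_le S B'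
  have h3 : Algebra.trdeg ℚ ↥(adjoin ℚ B') ≤ #B' := trdeg_adjoin_le_mk B'
  -- (3) #B' + #B₀ = #B
  have h4 : #B' + #B₀ = #B := Cardinal.mk_sdiff_add_mk hB₀B
  calc Algebra.trdeg ℚ ↥(adjoin ℚ (S ∪ T)) + Algebra.trdeg ℚ ↥M
      ≤ (Algebra.trdeg ℚ ↥(adjoin ℚ B') + Algebra.trdeg ℚ ↥(adjoin ℚ S)) + #B₀ :=
        add_le_add (h1.trans h2) hB₀card.ge
    _ = Algebra.trdeg ℚ ↥(adjoin ℚ S) + (Algebra.trdeg ℚ ↥(adjoin ℚ B') + #B₀) := by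
        rw [add_comm (Algebra.trdeg ℚ ↥(adjoin ℚ B')), add_assoc]
    _ ≤ Algebra.trdeg ℚ ↥(adjoin ℚ S) + (#B' + #B₀) := add_le_add le_rfl (add_le_add h3 le_rfl)
    _ = Algebra.trdeg ℚ ↥(adjoin ℚ S) + #B := by rw [h4]
    _ ≤ Algebra.trdeg ℚ ↥(adjoin ℚ S) + Algebra.trdeg ℚ ↥(adjoin ℚ T) := add_le_add le_rfl hBle

/-- GRADED FORM ON TUPLES: `t + σ ≤ t₁ + t₂` with `σ = trdeg_ℚ (ℚ(z) ∩ ℚ(e^z))` the SHARED DEGREE of the atom — the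
entanglement grade `ε = t₁ + t₂ − t` dominates `σ`; `D` (30353) is the cell `ε = 0`, hence `σ = 0` there. -/
theorem trdeg_add_sharedDegree_le {n : ℕ} (z : Fin n → ℂ) :
    Algebra.trdeg ℚ ↥(adjoin ℚ (Set.range z ∪ Set.range (cexp ∘ z))) +
        Algebra.trdeg ℚ ↥(adjoin ℚ (Set.range z) ⊓ adjoin ℚ (Set.range (cexp ∘ z))) ≤
      Algebra.trdeg ℚ ↥(adjoin ℚ (Set.range z)) + Algebra.trdeg ℚ ↥(adjoin ℚ (Set.range (cexp ∘ z))) :=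
  trdeg_union_add_trdeg_inf_le _ _

/-- **SHARED TRANSCENDENTAL ⟹ ENTANGLED** (`Cᵉ`'s last hypothesis): if `ℚ(z) ∩ ℚ(e^z)` contains a transcendental then
`trdeg ℚ(z, e^z) < trdeg ℚ(z) + trdeg ℚ(e^z)`. -/
theorem entangled_of_shared_transcendental {n : ℕ} (z : Fin n → ℂ) {s : ℂ}
    (hs₁ : s ∈ adjoin ℚ (Set.range z)) (hs₂ : s ∈ adjoin ℚ (Set.range (cexp ∘ z))) (hs : Transcendental ℚ s) :
    Algebra.trdeg ℚ ↥(adjoin ℚ (Set.range z ∪ Set.range (cexp ∘ z))) <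
      Algebra.trdeg ℚ ↥(adjoin ℚ (Set.range z)) + Algebra.trdeg ℚ ↥(adjoin ℚ (Set.range (cexp ∘ z))) := by
  have h := trdeg_union_add_one_le_of_shared hs₁ hs₂ hs
  refine lt_of_add_one_le_of_le_nat (n := n + n) ?_ h
  refine (trdeg_adjoin_le_mk _).trans ?_
  refine (Cardinal.mk_union_le _ _).trans ?_
  have h1 : #(Set.range z) ≤ (n : Cardinal) := by simpa using Cardinal.mk_range_le (f := z)
  have h2 : #(Set.range (cexp ∘ z)) ≤ (n : Cardinal) := by simpa using Cardinal.mk_range_le (f := cexp ∘ z)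
  exact_mod_cast add_le_add h1 h2

/-- **DISJOINT ATOMS SHARE ONLY ALGEBRAIC NUMBERS**: under `D`'s hypothesis `trdeg ℚ(z) + trdeg ℚ(e^z) ≤ trdeg ℚ(z, e^z)`
every element of `ℚ(z) ∩ ℚ(e^z)` is algebraic. -/
theorem isAlgebraic_of_mem_inf_of_disjoint {n : ℕ} (z : Fin n → ℂ)
    (hdis : Algebra.trdeg ℚ ↥(adjoin ℚ (Set.range z)) + Algebra.trdeg ℚ ↥(adjoin ℚ (Set.range (cexp ∘ z))) ≤
      Algebra.trdeg ℚ ↥(adjoin ℚ (Set.range z ∪ Set.range (cexp ∘ z))))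
    {s : ℂ} (hs₁ : s ∈ adjoin ℚ (Set.range z)) (hs₂ : s ∈ adjoin ℚ (Set.range (cexp ∘ z))) :
    IsAlgebraic ℚ s := by
  by_contra hs
  exact (not_lt.mpr hdis) (entangled_of_shared_transcendental z hs₁ hs₂ hs)

/-- A fixed point of `exp` is nonzero (`e⁰ = 1`) and transcendental (Hermite–Lindemann, tree theorem
`transcendental_exp_holds`; cf. `fixedPoint_ne_zero` in Theorems/RigidCoreSchanuelOnLogFreeCoreFixedPointCoreHL). -/
theorem transcendental_of_fixedPoint {ζ : ℂ} (hζ : cexp ζ = ζ) : Transcendental ℚ ζ := by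
  have h0 : ζ ≠ 0 := by rintro rfl; simp at hζ
  intro halg
  exact transcendental_exp_holds halg h0 (by rw [hζ]; exact halg)

/-- A Lambert point `Ω e^Ω = 1` (e.g. `Ω = W(1)`) is nonzero and transcendental (Hermite–Lindemann). -/
theorem transcendental_of_lambert {Ω : ℂ} (hΩ : Ω * cexp Ω = 1) : Transcendental ℚ Ω := by
  have h0 : Ω ≠ 0 := by rintro rfl; simp at hΩ
  have hexp : cexp Ω = Ω⁻¹ :=
    calc cexp Ω = Ω⁻¹ * (Ω * cexp Ω) := by rw [← mul_assoc, inv_mul_cancel₀ h0, one_mul]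
      _ = Ω⁻¹ := by rw [hΩ, mul_one]
  intro halg
  exact transcendental_exp_holds halg h0 (by rw [hexp]; exact halg.inv)

/-- **FIXED POINTS ENTANGLE**: a tuple whose ℚ-span contains a nonzero fixed point `e^ζ = ζ` is ENTANGLED — the
shared transcendental is `ζ^N = e^{Nζ}` for the denominator `N` of `ζ` in `span_ℤ z`.  Consequence (placement, TREE row (e)):
DLDK's first open cell `(π, iπ, ζ₀, conj ζ₀)` and every fixed-point atom sit on the `Cᵉ` side of the round-6 split. -/
theorem entangled_of_fixedPoint_mem_span {n : ℕ} (z : Fin n → ℂ) {ζ : ℂ} (hζ : cexp ζ = ζ)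
    (hmem : ζ ∈ Submodule.span ℚ (Set.range z)) :
    Algebra.trdeg ℚ ↥(adjoin ℚ (Set.range z ∪ Set.range (cexp ∘ z))) <
      Algebra.trdeg ℚ ↥(adjoin ℚ (Set.range z)) + Algebra.trdeg ℚ ↥(adjoin ℚ (Set.range (cexp ∘ z))) := by
  obtain ⟨N, hN, hNζ⟩ := exists_nsmul_mem_span_int z hmem
  have hpow : cexp ((N : ℚ) • ζ) = ζ ^ N := by
    rw [Nat.cast_smul_eq_nsmul, nsmul_eq_mul, Complex.exp_nat_mul, hζ]
  have hs₂ : ζ ^ N ∈ adjoin ℚ (Set.range (cexp ∘ z)) := by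
    rw [← hpow]; exact exp_mem_adjoin_exp_of_mem_span_int z hNζ
  have hζ₁ : ζ ∈ adjoin ℚ (Set.range z) := by
    have hle : Submodule.span ℚ (Set.range z) ≤ (adjoin ℚ (Set.range z)).toSubalgebra.toSubmodule := by
      rw [Submodule.span_le]; exact subset_adjoin ℚ _
    exact hle hmem
  have hs₁ : ζ ^ N ∈ adjoin ℚ (Set.range z) := pow_mem hζ₁ N
  exact entangled_of_shared_transcendental z hs₁ hs₂
    ((transcendental_of_fixedPoint hζ).pow (Nat.pos_of_ne_zero hN))

/-- … hence such a tuple never satisfies `D`'s disjointness hypothesis (30353 is vacuous on fixed-point atoms). -/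
theorem not_disjoint_of_fixedPoint_mem_span {n : ℕ} (z : Fin n → ℂ) {ζ : ℂ} (hζ : cexp ζ = ζ)
    (hmem : ζ ∈ Submodule.span ℚ (Set.range z)) :
    ¬ (Algebra.trdeg ℚ ↥(adjoin ℚ (Set.range z)) + Algebra.trdeg ℚ ↥(adjoin ℚ (Set.range (cexp ∘ z))) ≤
        Algebra.trdeg ℚ ↥(adjoin ℚ (Set.range z ∪ Set.range (cexp ∘ z)))) :=
  not_le.mpr (entangled_of_fixedPoint_mem_span z hζ hmem)

/-- The same for a fixed point occurring as a COORDINATE. -/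
theorem entangled_of_fixedPoint_coord {n : ℕ} (z : Fin n → ℂ) (i : Fin n) (hζ : cexp (z i) = z i) :
    Algebra.trdeg ℚ ↥(adjoin ℚ (Set.range z ∪ Set.range (cexp ∘ z))) <
      Algebra.trdeg ℚ ↥(adjoin ℚ (Set.range z)) + Algebra.trdeg ℚ ↥(adjoin ℚ (Set.range (cexp ∘ z))) :=
  entangled_of_fixedPoint_mem_span z hζ (Submodule.subset_span ⟨i, rfl⟩)

/-- **LAMBERT POINTS ENTANGLE**: a tuple whose ℚ-span contains an `Ω` with `Ω e^Ω = 1` is ENTANGLED (shared transcendental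
`Ω^N = e^{−NΩ}`).  Placement: the `W(1)`-atoms of route-E's dark-anchor analysis sit on the `Cᵉ` side of the split. -/
theorem entangled_of_lambert_mem_span {n : ℕ} (z : Fin n → ℂ) {Ω : ℂ} (hΩ : Ω * cexp Ω = 1)
    (hmem : Ω ∈ Submodule.span ℚ (Set.range z)) :
    Algebra.trdeg ℚ ↥(adjoin ℚ (Set.range z ∪ Set.range (cexp ∘ z))) <
      Algebra.trdeg ℚ ↥(adjoin ℚ (Set.range z)) + Algebra.trdeg ℚ ↥(adjoin ℚ (Set.range (cexp ∘ z))) := by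
  obtain ⟨N, hN, hNΩ⟩ := exists_nsmul_mem_span_int z hmem
  have h0 : Ω ≠ 0 := by rintro rfl; simp at hΩ
  have hexp : cexp Ω = Ω⁻¹ :=
    calc cexp Ω = Ω⁻¹ * (Ω * cexp Ω) := by rw [← mul_assoc, inv_mul_cancel₀ h0, one_mul]
      _ = Ω⁻¹ := by rw [hΩ, mul_one]
  have hpow : cexp ((N : ℚ) • Ω) = (Ω ^ N)⁻¹ := by
    rw [Nat.cast_smul_eq_nsmul, nsmul_eq_mul, Complex.exp_nat_mul, hexp, inv_pow]
  have hs₂ : Ω ^ N ∈ adjoin ℚ (Set.range (cexp ∘ z)) := by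
    have h := inv_mem (exp_mem_adjoin_exp_of_mem_span_int z hNΩ)
    rwa [hpow, inv_inv] at h
  have hΩ₁ : Ω ∈ adjoin ℚ (Set.range z) := by
    have hle : Submodule.span ℚ (Set.range z) ≤ (adjoin ℚ (Set.range z)).toSubalgebra.toSubmodule := by
      rw [Submodule.span_le]; exact subset_adjoin ℚ _
    exact hle hmem
  exact entangled_of_shared_transcendental z (pow_mem hΩ₁ N) hs₂
    ((transcendental_of_lambert hΩ).pow (Nat.pos_of_ne_zero hN))

/-- **EXPONENTIAL CHAINS ENTANGLE**: if some value `e^{z_i}` is itself a coordinate `z_j` and is transcendental, the tuple is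
ENTANGLED (shared transcendental `z_j`).  Covers the e-tower `(1, e, e²)` (`e^{z₀} = e = z₁`), the deep towers
`(1, e, e^e, …)` of route-E's `DeepTower` (29910) and every fixed-point atom (`i = j`): all on the `Cᵉ` side of the split. -/
theorem entangled_of_chain {n : ℕ} (z : Fin n → ℂ) (i j : Fin n) (h : cexp (z i) = z j)
    (ht : Transcendental ℚ (z j)) :
    Algebra.trdeg ℚ ↥(adjoin ℚ (Set.range z ∪ Set.range (cexp ∘ z))) <
      Algebra.trdeg ℚ ↥(adjoin ℚ (Set.range z)) + Algebra.trdeg ℚ ↥(adjoin ℚ (Set.range (cexp ∘ z))) :=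
  entangled_of_shared_transcendental z (subset_adjoin ℚ _ ⟨j, rfl⟩)
    (by rw [← h]; exact subset_adjoin ℚ _ ⟨i, rfl⟩) ht

/-- `e` is transcendental (Hermite–Lindemann at `α = 1`, tree theorem). -/
private theorem transcendental_e : Transcendental ℚ (cexp 1) :=
  transcendental_exp_holds isAlgebraic_one one_ne_zero

/-- PLACEMENT: the e-tower `(1, e, e²)` — the first open cell of the bidegree chart (g9) — is ENTANGLED, by the chain
`e^{z₀} = z₁ = e` (one line; g6 proved this by a degree count). -/
theorem eTower_entangled :
    Algebra.trdeg ℚ ↥(adjoin ℚ (Set.range ![(1 : ℂ), cexp 1, cexp 1 ^ 2] ∪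
        Set.range (cexp ∘ ![(1 : ℂ), cexp 1, cexp 1 ^ 2]))) <
      Algebra.trdeg ℚ ↥(adjoin ℚ (Set.range ![(1 : ℂ), cexp 1, cexp 1 ^ 2])) +
        Algebra.trdeg ℚ ↥(adjoin ℚ (Set.range (cexp ∘ ![(1 : ℂ), cexp 1, cexp 1 ^ 2]))) :=
  entangled_of_chain _ 0 1 (by simp) (by simpa using transcendental_e)

/-- PLACEMENT: the deep tower `(1, e, e^e)` (route-E `DeepTower` 29910's first cell) is ENTANGLED, by the same chain. -/
theorem deepTower_entangled :
    Algebra.trdeg ℚ ↥(adjoin ℚ (Set.range ![(1 : ℂ), cexp 1, cexp (cexp 1)] ∪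
        Set.range (cexp ∘ ![(1 : ℂ), cexp 1, cexp (cexp 1)]))) <
      Algebra.trdeg ℚ ↥(adjoin ℚ (Set.range ![(1 : ℂ), cexp 1, cexp (cexp 1)])) +
        Algebra.trdeg ℚ ↥(adjoin ℚ (Set.range (cexp ∘ ![(1 : ℂ), cexp 1, cexp (cexp 1)]))) :=
  entangled_of_chain _ 0 1 (by simp) (by simpa using transcendental_e)

end Summit.Schanuel.Schanuel.Theorems.RootDecomp1SharedDegree

end
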